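import Literature.AlgebraicGeometry.Deformation.EquivariantPolarisedFirstOrderDeformations
import Literature.AlgebraicGeometry.HodgeTheory.AtiyahClassTraceReal
import Literature.AlgebraicGeometry.HodgeTheory.CotangentSheafPullbackHom
import Mathlib.Algebra.Homology.DerivedCategory.Ext.Basic
import Mathlib.CategoryTheory.Limits.Shapes.Biproducts
import Mathlib.CategoryTheory.Abelian.Basic
import HarnessLib

/-!
# Reading the first-order obstruction `ob_L : T¹(X/S) → Ext²(L, L)` block by block: the cotangent (Künneth) blocks of
# `T¹` of a product, the carrier `H²(X, 𝒪_X)` of the obstruction of a line bundle, and block detection along a family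

Layer `Literature/AlgebraicGeometry/Deformation`, namespace `Literature.AlgebraicGeometry.Deformation.FirstOrder` (definition item
`defn-KunnethLetterDictionary`, the companion of `defn-WeilTangentFamilyConstruction`: «Künneth block projectors on
`Ext²(L,L) = H²(𝒪_X)` for a box-product line bundle on a product of abelian varieties, and the obstruction map
`ob(L) : T¹(X) → Ext²(L,L)` of a box product read block by block», typed IN GENERAL).  Everything here is a DEFINITION with a
body or a PROVED lemma; no named fact, no `sorry`, no `instance`, no `notation`.

## §1 Reading an additive obstruction map block by block (bookkeeping, any additive groups)

For an additive map `ob : T →+ M` («obstruction»), a family `W ⊆ T` of directions and a «block reader» `π : M →+ N`: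
* `BlockVanishesAlong π ob W` — `∀ κ ∈ W, π (ob κ) = 0`; `BlockDetectsAlong π ob W` — `∃ κ ∈ W, π (ob κ) ≠ 0` (the block of
  `ob` is non-zero for some direction of the family); `not_blockDetectsAlong_iff`, monotonicity in `W`;
* `JointlyInjective π` for a family of readers `π i : M →+ N i` («the blocks separate classes», e.g. the components of a direct-sum
  decomposition, `jointlyInjective_of_addEquiv`); **`forall_eq_zero_iff_forall_blockVanishesAlong`**: for a jointly injective
  family, `ob` vanishes along `W` iff EVERY block vanishes along `W` iff NO block detects along `W`.
This is the shape in which an obstruction class in `Ext²` ∕ `H²` is read on a Künneth decomposition of the target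
([HuybrechtsThomas2010, Cor. 3.4]: `E` extends along `κ` iff `ob_κ(E) = 0`; a class in a direct sum vanishes iff all its components do).

## §2 The obstruction of a bundle read in `H²(X, 𝒪_X)`: `σ_0 ∘ ob` (real carriers)

For `X/S` with `Ω¹_{X/S}` finite locally free and `E` finite locally free:
* `obstructionTraceExt hΩ hE : T¹(X/S) →+ Ext²(𝒪_X, 𝒪_X)`, `κ ↦ Tr(ob_κ(E))` — the TREE's obstruction homomorphism
  `kodairaSpencerObstructionHom` (`(id_E ⊗ κ) ∘ At(E)`, [HuybrechtsThomas2010, Cor. 3.4]) followed by the TREE's trace on `Ext`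
  (`HodgeTheory.traceExt`, [BuchweitzFlenner2003, §4]);
* `obstructionTrace hΩ hE : T¹(X/S) →+ H²(X, 𝒪_X)`, `κ ↦ σ_0(ob_κ(E))` — followed instead by `σ_0 = Tr : Ext²(E,E) → H²(X, 𝒪_X)`
  (`HodgeTheory.sigmaZero`), «the map between obstruction spaces for the deformations of `F` versus those of its determinant»
  [BuchweitzFlenner2003, §1 (σ_0)].  For a LINE bundle `L` the trace `𝓔nd(L) → 𝒪_X` is an isomorphism, so `σ_0` is the
  identification `Ext²(L, L) = H²(X, 𝒪_X)` ([Hartshorne1977, III.6.3 (c), III.6.7]; its bijectivity is not proved in the tree) and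
  `obstructionTrace hΩ hL κ ∈ H²(X, 𝒪_X)` is the obstruction to deforming `L` along `κ` on the carrier COMMON TO ALL line bundles on
  `X` — the carrier on which Künneth blocks are read uniformly in `L`;
* `obstructionTrace_eq_zero_of_mem_polarisedSubgroup`, `polarisedSubgroup_le_ker_obstructionTrace`,
  `blockVanishesAlong_obstructionTrace_of_subset`: along `T¹(X/S)_{E} = ker ob_E` every block of the traced obstruction vanishes;
  `subset_polarisedSubgroup_of_forall_blockVanishesAlong`: conversely for `E` `0`-semiregular (`σ_0` injective — automatic reading for
  line bundles) and a jointly injective reader family.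

## §3 The cotangent (Künneth) blocks of `T¹` of a product (real carriers)

For a morphism `f : X ⟶ Y` of `S`-schemes, `cotangentRestrict f : T¹(X/S) →+ Ext¹(f^*Ω¹_{Y/S}, 𝒪_X)`, `κ ↦ κ ∘ df`
(`df = cotangentSheaf.pullbackHom f : f^*Ω¹_{Y/S} → Ω¹_{X/S}`, [Hartshorne1977, II Prop. 8.11]) — the part of a first-order
deformation of `X` seen by the `1`-forms pulled back from `Y`.  For a finite family of `S`-morphisms `p j : X ⟶ Y j` (the
projections of a product `X = ∏_j Y_j`) satisfying the PRODUCT FORMULA «`(dp_j)_j : ⊕_j p_j^*Ω¹_{Y_j/S} ⟶ Ω¹_{X/S}` is an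
isomorphism» ([Hartshorne1977, II Ex. 8.3 (a)]; [GortzWedhorn2023, Cor. 17.32]; taken as the HYPOTHESIS `IsIso (biproduct.desc dp)`,
as in the tree's `HodgeTheory/CotangentSheafProductFormulaTransport` — the sheaf-level product formula is not yet in the tree):
* **`cotangentBlocksEquiv p hp : T¹(X/S) ≃+ Π j, Ext¹(p_j^*Ω¹_{Y_j/S}, 𝒪_X)`** with components `cotangentRestrict (p j)`
  (`cotangentBlocksEquiv_apply`; Mathlib `Ext.biproductAddEquiv`: `Ext` is additive in the first variable) — the decomposition
  `T¹(∏ Y_j) = ⊕_j Ext¹(p_j^*Ω¹_{Y_j}, 𝒪)` of first-order deformations of a product by the factor whose `1`-forms they move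
  (for abelian varieties `Y_j` with `H¹(X, 𝒪_X) = ⊕_g p_g^* H¹(Y_g, 𝒪)` these are the columns `j` of the `(g, j)` Künneth blocks
  `H¹(𝒪_{Y_g}) ⊗ H⁰(𝒯_{Y_j})` of `H¹(X, 𝒯_X)`);
* **`cotangentRestrict_jointlyInjective`**: a first-order deformation of the product is zero iff every cotangent block is.

## §4 Obstruction blocks along a family

`ObstructionBlockDetectsAlong hΩ hE π W := BlockDetectsAlong π (obstructionTrace hΩ hE) W` — «the `π`-block of `ob(L) κ` is
non-zero for some `κ ∈ W`», for ANY reader `π : H²(X, 𝒪_X) →+ N`; `not_obstructionBlockDetectsAlong_of_subset_polarisedSubgroup`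
(no block detects along a family that preserves `L`), `forall_not_obstructionBlockDetectsAlong_iff` (for `σ_0` injective and a
jointly injective reader family: no block detects along `W` iff `W ⊆ T¹(X/S)_{L}`).

## NOT typed here (honest scope, recorded for the requester)

(1) The Künneth PROJECTORS themselves — the intended jointly injective readers `π_{(g,h)} : H²(X, 𝒪_X) → H^a(𝒪_{Y_g}) ⊗ H^b(𝒪_{Y_h})`
of a product `X = ∏ Y_j` over a field ([StacksProject, Tag 0BEC]; [MumfordAV1970, §13]): the tree proves Künneth for the ČECH
cohomology of `𝒪` on product covers (`Modules/CechProductCoverKunnethComponents`, `Modules/CechKunnethInjective`), not on the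
`Sheaf.H` ∕ `Ext` carriers used by `σ_0`; every statement of §1 ∕ §4 therefore takes the reader family as a PARAMETER.
(2) The Buchweitz–Flenner identity in form degree `0`, `σ_0(ob_κ(E)) = ⟨κ, c₁(E)⟩` (for a line bundle: `ob_κ(L) = κ ∪ c₁(L)`),
and `c₁` of a box product `⊗_j p_j^* L_j` as `Σ_j p_j^* c₁(L_j)` — the tree records the missing contraction carrier
(`HodgeTheory/KodairaSpencerObstructionClass`, «What (F-BF) needs»).  (3) Any evaluation on specific line bundles.

## References
* [HuybrechtsThomas2010] D. Huybrechts, R. P. Thomas, Math. Ann. 346 (2010), Def. 2.7, Cor. 3.4 (arXiv:0805.3527 pp. 7, 10).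
* [BuchweitzFlenner2003] R.-O. Buchweitz, H. Flenner, Compositio Math. 137 (2003), §1 (`σ_0`), §4 (trace), Def. 4.1.
* [Hartshorne1977] R. Hartshorne, *Algebraic Geometry* (1977), II Prop. 8.11, II Ex. 8.3 (a), III.6.3 (c), III.6.7.
* [GortzWedhorn2023] U. Görtz, T. Wedhorn, *Algebraic Geometry II* (2023), Cor. 17.32.
* [StacksProject] Tag 0BEC.  [MumfordAV1970] D. Mumford, *Abelian Varieties*, §13.
-/

noncomputable section

set_option autoImplicit false

open CategoryTheory CategoryTheory.Abelian CategoryTheory.Limits AlgebraicGeometry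
open AlgebraicGeometry.Scheme.Modules
open Literature.AlgebraicGeometry Literature.AlgebraicGeometry.Modules Literature.AlgebraicGeometry.Motives
open Literature.AlgebraicGeometry.HodgeTheory

namespace Literature.AlgebraicGeometry.Deformation.FirstOrder

universe w u v v₁ v₂ v₃

/-! ## §1 Reading an additive map block by block -/

section Blocks

variable {T : Type v₁} {M : Type v₂} {N : Type v₃} [AddCommGroup T] [AddCommGroup M] [AddCommGroup N]

/-- **The `π`-block of `ob` VANISHES along the family `W`**: `∀ κ ∈ W, π (ob κ) = 0`.  Shape: `ob` an obstruction homomorphism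
(e.g. `κ ↦ ob_κ(E)`), `π` a component of a direct-sum (Künneth) decomposition of its target.
[cite: HuybrechtsThomas2010, Cor. 3.4 (arXiv p. 10) (E extends along κ iff ob_κ(E) = 0; reading: componentwise on a decomposition of Ext²)] -/
def BlockVanishesAlong (π : M →+ N) (ob : T →+ M) (W : Set T) : Prop :=
  ∀ κ ∈ W, π (ob κ) = 0

/-- **The `π`-block of `ob` DETECTS along the family `W`**: `π (ob κ) ≠ 0` for some `κ ∈ W`.
[cite: HuybrechtsThomas2010, Cor. 3.4 (arXiv p. 10) (reading: a non-zero component of the obstruction)] -/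
def BlockDetectsAlong (π : M →+ N) (ob : T →+ M) (W : Set T) : Prop :=
  ∃ κ ∈ W, π (ob κ) ≠ 0

variable (π : M →+ N) (ob : T →+ M) (W : Set T)

/-- Unfolding `BlockVanishesAlong`. [cite: HuybrechtsThomas2010, Cor. 3.4 (arXiv p. 10) (reading: the criterion ob_κ(E) = 0 read componentwise on a decomposition of Ext²)] -/
lemma blockVanishesAlong_iff : BlockVanishesAlong π ob W ↔ ∀ κ ∈ W, π (ob κ) = 0 := Iff.rfl

/-- Unfolding `BlockDetectsAlong`. [cite: HuybrechtsThomas2010, Cor. 3.4 (arXiv p. 10) (reading: the criterion ob_κ(E) = 0 read componentwise on a decomposition of Ext²)] -/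
lemma blockDetectsAlong_iff : BlockDetectsAlong π ob W ↔ ∃ κ ∈ W, π (ob κ) ≠ 0 := Iff.rfl

/-- no detection iff vanishing. [cite: HuybrechtsThomas2010, Cor. 3.4 (arXiv p. 10) (reading: the criterion ob_κ(E) = 0 read componentwise on a decomposition of Ext²)] -/
lemma not_blockDetectsAlong_iff : ¬ BlockDetectsAlong π ob W ↔ BlockVanishesAlong π ob W := by
  simp only [BlockDetectsAlong, BlockVanishesAlong, ne_eq, not_exists, not_and, not_not]

/-- detection iff not vanishing. [cite: HuybrechtsThomas2010, Cor. 3.4 (arXiv p. 10) (reading: the criterion ob_κ(E) = 0 read componentwise on a decomposition of Ext²)] -/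
lemma blockDetectsAlong_iff_not_blockVanishesAlong : BlockDetectsAlong π ob W ↔ ¬ BlockVanishesAlong π ob W := by
  rw [← not_blockDetectsAlong_iff, not_not]

/-- vanishing of the `π`-block along `W` is `W ⊆ ker (π ∘ ob)`. [cite: HuybrechtsThomas2010, Cor. 3.4 (arXiv p. 10) (reading: the criterion ob_κ(E) = 0 read componentwise on a decomposition of Ext²)] -/
lemma blockVanishesAlong_iff_subset_ker : BlockVanishesAlong π ob W ↔ W ⊆ ((π.comp ob).ker : Set T) := by
  refine ⟨fun h κ hκ => ?_, fun h κ hκ => ?_⟩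
  · exact (AddMonoidHom.mem_ker).2 (h κ hκ)
  · exact (AddMonoidHom.mem_ker).1 (h hκ)

variable {π ob W}

/-- vanishing is inherited by sub-families. [cite: HuybrechtsThomas2010, Cor. 3.4 (arXiv p. 10) (reading: the criterion ob_κ(E) = 0 read componentwise on a decomposition of Ext²)] -/
lemma BlockVanishesAlong.mono {W' : Set T} (hWW' : W ⊆ W') (h : BlockVanishesAlong π ob W') :
    BlockVanishesAlong π ob W := fun κ hκ => h κ (hWW' hκ)

/-- detection is inherited by super-families. [cite: HuybrechtsThomas2010, Cor. 3.4 (arXiv p. 10) (reading: the criterion ob_κ(E) = 0 read componentwise on a decomposition of Ext²)] -/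
lemma BlockDetectsAlong.mono {W' : Set T} (hWW' : W ⊆ W') (h : BlockDetectsAlong π ob W) :
    BlockDetectsAlong π ob W' := by
  obtain ⟨κ, hκ, hne⟩ := h
  exact ⟨κ, hWW' hκ, hne⟩

/-- the empty family detects nothing. [cite: HuybrechtsThomas2010, Cor. 3.4 (arXiv p. 10) (reading: the criterion ob_κ(E) = 0 read componentwise on a decomposition of Ext²)] -/
lemma not_blockDetectsAlong_empty : ¬ BlockDetectsAlong π ob (∅ : Set T) := by
  rintro ⟨κ, hκ, -⟩
  exact hκ

/-- if `ob` itself vanishes along `W`, every block vanishes along `W`. [cite: HuybrechtsThomas2010, Cor. 3.4 (arXiv p. 10) (reading: the criterion ob_κ(E) = 0 read componentwise on a decomposition of Ext²)] -/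
lemma blockVanishesAlong_of_forall_eq_zero (h : ∀ κ ∈ W, ob κ = 0) : BlockVanishesAlong π ob W :=
  fun κ hκ => by rw [h κ hκ, map_zero]

/-- a detecting block witnesses a direction along which `ob` is non-zero. [cite: HuybrechtsThomas2010, Cor. 3.4 (arXiv p. 10) (reading: the criterion ob_κ(E) = 0 read componentwise on a decomposition of Ext²)] -/
lemma BlockDetectsAlong.exists_ne_zero (h : BlockDetectsAlong π ob W) : ∃ κ ∈ W, ob κ ≠ 0 := by
  obtain ⟨κ, hκ, hne⟩ := h
  refine ⟨κ, hκ, fun h0 => hne ?_⟩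
  rw [h0, map_zero]

/-- **A family of readers is JOINTLY INJECTIVE** («the blocks separate classes»): a class all of whose blocks vanish is zero —
the property of the components of a direct-sum decomposition (e.g. Künneth components). [cite: StacksProject, Tag 0BEC (Künneth decomposition; reading: a class vanishes iff all its Künneth components vanish)] -/
def JointlyInjective {ι : Type v} {N' : ι → Type v₃} [∀ i, AddCommGroup (N' i)] (π' : (i : ι) → (M →+ N' i)) : Prop :=
  ∀ x : M, (∀ i, π' i x = 0) → x = 0

variable {ι : Type v} {N' : ι → Type v₃} [∀ i, AddCommGroup (N' i)] {π' : (i : ι) → (M →+ N' i)}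

/-- Unfolding `JointlyInjective`. [cite: StacksProject, Tag 0BEC (Künneth decomposition; reading: a class vanishes iff all its Künneth components vanish)] -/
lemma jointlyInjective_iff (π'' : (i : ι) → (M →+ N' i)) :
    JointlyInjective π'' ↔ ∀ x : M, (∀ j, π'' j x = 0) → x = 0 := Iff.rfl

/-- the components of an additive isomorphism onto a product are jointly injective (the shape delivered by a direct-sum
decomposition, e.g. Mathlib's `Ext.biproductAddEquiv`). [cite: StacksProject, Tag 0BEC (Künneth decomposition; reading: a class vanishes iff all its Künneth components vanish)] -/
lemma jointlyInjective_of_addEquiv (e : M ≃+ ((i : ι) → N' i)) :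
    JointlyInjective (fun i => (Pi.evalAddMonoidHom N' i).comp e.toAddMonoidHom) := by
  intro x hx
  apply e.injective
  rw [map_zero]
  funext i
  exact hx i

/-- for jointly injective readers `x = 0 ↔ ∀ i, π i x = 0`. [cite: StacksProject, Tag 0BEC (Künneth decomposition; reading: a class vanishes iff all its Künneth components vanish)] -/
lemma JointlyInjective.eq_zero_iff (hπ : JointlyInjective π') (x : M) : x = 0 ↔ ∀ i, π' i x = 0 :=
  ⟨fun h _ => by rw [h, map_zero], hπ x⟩

/-- **`ob` vanishes along `W` iff every block does** (jointly injective readers). [cite: StacksProject, Tag 0BEC (Künneth decomposition; reading: a class vanishes iff all its Künneth components vanish)] -/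
theorem forall_eq_zero_iff_forall_blockVanishesAlong (hπ : JointlyInjective π') :
    (∀ κ ∈ W, ob κ = 0) ↔ ∀ i, BlockVanishesAlong (π' i) ob W :=
  ⟨fun h _ => blockVanishesAlong_of_forall_eq_zero h, fun h κ hκ => hπ _ fun i => h i κ hκ⟩

/-- **`ob` vanishes along `W` iff no block detects along `W`** (jointly injective readers). [cite: StacksProject, Tag 0BEC (Künneth decomposition; reading: a class vanishes iff all its Künneth components vanish)] -/
theorem forall_eq_zero_iff_forall_not_blockDetectsAlong (hπ : JointlyInjective π') :
    (∀ κ ∈ W, ob κ = 0) ↔ ∀ i, ¬ BlockDetectsAlong (π' i) ob W := by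
  rw [forall_eq_zero_iff_forall_blockVanishesAlong hπ]
  exact forall_congr' fun i => (not_blockDetectsAlong_iff (π' i) ob W).symm

/-- some block detects iff `ob` is non-zero somewhere along `W` (jointly injective readers). [cite: StacksProject, Tag 0BEC (Künneth decomposition; reading: a class vanishes iff all its Künneth components vanish)] -/
theorem exists_blockDetectsAlong_iff (hπ : JointlyInjective π') :
    (∃ i, BlockDetectsAlong (π' i) ob W) ↔ ∃ κ ∈ W, ob κ ≠ 0 := by
  constructor
  · rintro ⟨i, h⟩
    exact h.exists_ne_zero
  · rintro ⟨κ, hκ, hne⟩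
    by_contra h
    rw [not_exists] at h
    exact hne (((forall_eq_zero_iff_forall_not_blockDetectsAlong hπ).2 h) κ hκ)

end Blocks

/-! ## §2 The obstruction read in `H²(X, 𝒪_X)`: `κ ↦ σ_0(ob_κ(E)) = Tr((id_E ⊗ κ) ∘ At(E))` -/

section Trace

variable {S : Type u} [CommRing S] {X : Over (Spec (CommRingCat.of S))} [HasExt.{w} X.left.Modules]
  (hΩ : IsFiniteLocallyFree (cotangentSheaf X)) {E : X.left.Modules} (hE : IsFiniteLocallyFree E)

/-- **`κ ↦ Tr(ob_κ(E)) ∈ Ext²(𝒪_X, 𝒪_X)`** — the obstruction homomorphism `ob_E : T¹(X/S) → Ext²(E, E)`, `κ ↦ (id_E ⊗ κ) ∘ At(E)`,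
followed by the trace on `Ext` (`HodgeTheory.traceExt`: `𝓗om(E, –)`, unit and `tr : 𝓔nd(E) → 𝒪_X`).  For a line bundle `L`
(`𝓔nd(L) = 𝒪_X`) this is the obstruction `ob_κ(L)` itself on the carrier `Ext²(𝒪_X, 𝒪_X)`.
[cite: HuybrechtsThomas2010, Cor. 3.4 (arXiv p. 10)] [cite: BuchweitzFlenner2003, §4 (trace map Tr : Ext^k(F, F ⊗ G) → H^k(X, G))] -/
def obstructionTraceExt : DefT1.{w} X →+ Ext.{w} (unitModule X.left) (unitModule X.left) 2 :=
  (traceExt hE 2).comp (kodairaSpencerObstructionHom hΩ hE)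

/-- **`κ ↦ σ_0(ob_κ(E)) ∈ H²(X, 𝒪_X)`** — the obstruction homomorphism followed by `σ_0 = Tr : Ext²(E, E) → H²(X, 𝒪_X)`
(`HodgeTheory.sigmaZero`), «the map between obstruction spaces for the deformations of `F` versus those of its determinant».
For a LINE bundle `L` the trace `𝓔nd(L) → 𝒪_X` is an isomorphism and `σ_0` is the identification `Ext²(L, L) = H²(X, 𝒪_X)`, so this
is the obstruction to deforming `L` along `κ`, read on the carrier `H²(X, 𝒪_X)` common to all line bundles on `X`.
[cite: BuchweitzFlenner2003, §1 (σ_0 : Ext²_X(F,F) → H²(X, 𝒪_X)) and Def. 4.1] [cite: HuybrechtsThomas2010, Cor. 3.4 (arXiv p. 10)]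
[cite: Hartshorne1977, III.6.3 (c) and III.6.7 (Extⁱ(𝒪_X, G) ≅ Hⁱ(X, G), Ext of locally free sheaves)] -/
def obstructionTrace : DefT1.{w} X →+ structureSheafCohomology X.left 2 :=
  (sigmaZero hE).comp (kodairaSpencerObstructionHom hΩ hE)

/-- Unfolding: `obstructionTraceExt κ = Tr(ob_κ(E))`. [cite: BuchweitzFlenner2003, §4 (trace map)] -/
lemma obstructionTraceExt_apply (κ : DefT1.{w} X) :
    obstructionTraceExt hΩ hE κ = traceExt hE 2 (kodairaSpencerObstruction hΩ hE κ) := rfl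

/-- Unfolding: `obstructionTrace κ = σ_0(ob_κ(E))`. [cite: BuchweitzFlenner2003, §1 (σ_0)] -/
lemma obstructionTrace_apply (κ : DefT1.{w} X) :
    obstructionTrace hΩ hE κ = sigmaZero hE (kodairaSpencerObstruction hΩ hE κ) := rfl

/-- `obstructionTrace` is `obstructionTraceExt` followed by the comparison `Ext²(𝒪_X, 𝒪_X) → H²(X, 𝒪_X)`
(`HodgeTheory.extToCohomology`). [cite: Hartshorne1977, III.6.3 (c) (Extⁱ(𝒪_X, G) ≅ Hⁱ(X, G))] -/
lemma obstructionTrace_eq_extToCohomology (κ : DefT1.{w} X) :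
    obstructionTrace hΩ hE κ = extToCohomology (unitModule X.left) 2 (obstructionTraceExt hΩ hE κ) := rfl

/-- `σ_0(ob_0(E)) = 0`. [cite: HuybrechtsThomas2010, Cor. 3.4 (arXiv p. 10)] -/
lemma obstructionTrace_zero : obstructionTrace hΩ hE 0 = 0 := map_zero _

/-- `Tr(ob_0(E)) = 0`. [cite: HuybrechtsThomas2010, Cor. 3.4 (arXiv p. 10)] -/
lemma obstructionTraceExt_zero : obstructionTraceExt hΩ hE 0 = 0 := map_zero _

/-- a class along which `E` extends (`κ ∈ T¹(X/S)_{E} = ker ob_E`) has vanishing traced obstruction.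
[cite: HuybrechtsThomas2010, Cor. 3.4 (arXiv p. 10)] [cite: BuchweitzFlenner2003, §1 (σ_0)] -/
lemma obstructionTrace_eq_zero_of_mem_polarisedSubgroup {κ : DefT1.{w} X} (hκ : κ ∈ polarisedSubgroup hΩ hE) :
    obstructionTrace hΩ hE κ = 0 := by
  rw [obstructionTrace_apply, (mem_polarisedSubgroup_iff hΩ hE κ).1 hκ, map_zero]

/-- same on the carrier `Ext²(𝒪_X, 𝒪_X)`. [cite: HuybrechtsThomas2010, Cor. 3.4 (arXiv p. 10)] -/
lemma obstructionTraceExt_eq_zero_of_mem_polarisedSubgroup {κ : DefT1.{w} X} (hκ : κ ∈ polarisedSubgroup hΩ hE) :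
    obstructionTraceExt hΩ hE κ = 0 := by
  rw [obstructionTraceExt_apply, (mem_polarisedSubgroup_iff hΩ hE κ).1 hκ, map_zero]

/-- `T¹(X/S)_{E} ≤ ker (σ_0 ∘ ob_E)`. [cite: HuybrechtsThomas2010, Cor. 3.4 (arXiv p. 10)] [cite: BuchweitzFlenner2003, §1 (σ_0)] -/
lemma polarisedSubgroup_le_ker_obstructionTrace : polarisedSubgroup hΩ hE ≤ (obstructionTrace hΩ hE).ker :=
  fun _ hκ => (AddMonoidHom.mem_ker).2 (obstructionTrace_eq_zero_of_mem_polarisedSubgroup hΩ hE hκ)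

/-- for `E` `0`-semiregular (`σ_0` injective; the reading for line bundles) the traced obstruction has the SAME kernel as `ob_E`:
`ker (σ_0 ∘ ob_E) = T¹(X/S)_{E}`. [cite: BuchweitzFlenner2003, §1 (k-semiregular: σ_k injective)] [cite: HuybrechtsThomas2010, Cor. 3.4 (arXiv p. 10)] -/
theorem ker_obstructionTrace_eq_of_isZeroSemiregular (hσ : IsZeroSemiregular hE) :
    (obstructionTrace hΩ hE).ker = polarisedSubgroup hΩ hE := by
  refine le_antisymm (fun κ hκ => ?_) (polarisedSubgroup_le_ker_obstructionTrace hΩ hE)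
  rw [AddMonoidHom.mem_ker, obstructionTrace_apply] at hκ
  refine (mem_polarisedSubgroup_iff hΩ hE κ).2 (hσ ?_)
  rw [hκ, map_zero]

variable {N : Type v₃} [AddCommGroup N]

/-- **along a family that preserves `E` every block of the traced obstruction vanishes**: `W ⊆ T¹(X/S)_{E}` ⇒
`BlockVanishesAlong π (σ_0 ∘ ob_E) W` for ANY reader `π`. [cite: HuybrechtsThomas2010, Cor. 3.4 (arXiv p. 10)] -/
theorem blockVanishesAlong_obstructionTrace_of_subset (π : structureSheafCohomology X.left 2 →+ N) {W : Set (DefT1.{w} X)}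
    (hW : W ⊆ (polarisedSubgroup hΩ hE : Set (DefT1.{w} X))) : BlockVanishesAlong π (obstructionTrace hΩ hE) W :=
  blockVanishesAlong_of_forall_eq_zero fun _ hκ => obstructionTrace_eq_zero_of_mem_polarisedSubgroup hΩ hE (hW hκ)

/-- **conversely, for `σ_0` injective and jointly injective readers**: if every block of the traced obstruction vanishes along `W`
then `W` preserves `E` (`W ⊆ T¹(X/S)_{E}`). [cite: BuchweitzFlenner2003, §1 (σ_0 injective)] [cite: HuybrechtsThomas2010, Cor. 3.4 (arXiv p. 10)] -/
theorem subset_polarisedSubgroup_of_forall_blockVanishesAlong {ι : Type v} {N' : ι → Type v₃} [∀ i, AddCommGroup (N' i)]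
    {π' : (i : ι) → (structureSheafCohomology X.left 2 →+ N' i)} (hπ : JointlyInjective π') (hσ : IsZeroSemiregular hE)
    {W : Set (DefT1.{w} X)} (h : ∀ i, BlockVanishesAlong (π' i) (obstructionTrace hΩ hE) W) :
    W ⊆ (polarisedSubgroup hΩ hE : Set (DefT1.{w} X)) := by
  intro κ hκ
  have h0 : obstructionTrace hΩ hE κ = 0 := (forall_eq_zero_iff_forall_blockVanishesAlong hπ).2 h κ hκ
  have : κ ∈ (obstructionTrace hΩ hE).ker := (AddMonoidHom.mem_ker).2 h0
  rw [ker_obstructionTrace_eq_of_isZeroSemiregular hΩ hE hσ] at this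
  exact this

end Trace

/-! ## §3 The cotangent (Künneth) blocks of `T¹(X/S)` along morphisms and on a product -/

section Cotangent

variable {S : Type u} [CommRing S] {X Y : Over (Spec (CommRingCat.of S))} [HasExt.{w} X.left.Modules]

/-- **`κ ↦ κ ∘ df ∈ Ext¹(f^*Ω¹_{Y/S}, 𝒪_X)`** — the restriction of a first-order deformation class of `X/S` to the `1`-forms pulled
back along `f : X ⟶ Y` (`df = cotangentSheaf.pullbackHom f : f^*Ω¹_{Y/S} ⟶ Ω¹_{X/S}`); for `f` a projection of a product this
is the cotangent (Künneth) block of `κ` belonging to that factor. [cite: Hartshorne1977, II Prop. 8.11 (f^*Ω_{Y/S} → Ω_{X/S}) and III §6 (functoriality of Ext)] -/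
def cotangentRestrict (f : X ⟶ Y) :
    DefT1.{w} X →+ Ext.{w} ((Scheme.Modules.pullback f.left).obj (cotangentSheaf Y)) (unitModule X.left) 1 :=
  (Ext.mk₀ (cotangentSheaf.pullbackHom f)).precomp (unitModule X.left) (zero_add 1)

/-- Unfolding: `cotangentRestrict f κ = df · κ` (Yoneda composite `f^*Ω¹_{Y/S} → Ω¹_{X/S} → 𝒪_X[1]`).
[cite: Hartshorne1977, II Prop. 8.11 and III §6] -/
lemma cotangentRestrict_apply (f : X ⟶ Y) (κ : DefT1.{w} X) :
    cotangentRestrict f κ = (Ext.mk₀ (cotangentSheaf.pullbackHom f)).comp κ (zero_add 1) := rfl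

/-- `cotangentRestrict f 0 = 0`. [cite: Hartshorne1977, III §6 (Ext is additive)] -/
lemma cotangentRestrict_zero (f : X ⟶ Y) : cotangentRestrict f (0 : DefT1.{w} X) = 0 := map_zero _

/-! ### Binary products -/

variable {Y₁ Y₂ : Over (Spec (CommRingCat.of S))} (p₁ : X ⟶ Y₁) (p₂ : X ⟶ Y₂)

/-- `(dp₁, dp₂) : p₁^*Ω¹_{Y₁/S} ⊞ p₂^*Ω¹_{Y₂/S} ⟶ Ω¹_{X/S}`; the PRODUCT FORMULA for `X = Y₁ ×_S Y₂` says this is an isomorphism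
(the hypothesis shape of the tree's `HodgeTheory/CotangentSheafProductFormulaTransport`).
[cite: Hartshorne1977, II Ex. 8.3 (a) (Ω_{X×Y/S} ≅ p₁^*Ω_{X/S} ⊕ p₂^*Ω_{Y/S})] [cite: GortzWedhorn2023, Cor. 17.32] -/
abbrev cotangentProdComparison :
    (Scheme.Modules.pullback p₁.left).obj (cotangentSheaf Y₁) ⊞ (Scheme.Modules.pullback p₂.left).obj (cotangentSheaf Y₂) ⟶
      cotangentSheaf X :=
  biprod.desc (cotangentSheaf.pullbackHom p₁) (cotangentSheaf.pullbackHom p₂)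

/-- pre-composition with `(dp₁, dp₂)`: `κ ↦ (dp₁, dp₂) · κ ∈ Ext¹(p₁^*Ω¹ ⊞ p₂^*Ω¹, 𝒪_X)`. [cite: Hartshorne1977, II Ex. 8.3 (a) and III §6] -/
def cotangentProdRestrict :
    DefT1.{w} X →+
      Ext.{w} ((Scheme.Modules.pullback p₁.left).obj (cotangentSheaf Y₁) ⊞ (Scheme.Modules.pullback p₂.left).obj (cotangentSheaf Y₂))
        (unitModule X.left) 1 :=
  (Ext.mk₀ (cotangentProdComparison p₁ p₂)).precomp (unitModule X.left) (zero_add 1)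

/-- Unfolding `cotangentProdRestrict`. [cite: Hartshorne1977, II Ex. 8.3 (a) and III §6] -/
lemma cotangentProdRestrict_apply (κ : DefT1.{w} X) :
    cotangentProdRestrict p₁ p₂ κ = (Ext.mk₀ (cotangentProdComparison p₁ p₂)).comp κ (zero_add 1) := rfl

/-- the first component of `(dp₁, dp₂) · κ` is the cotangent block `dp₁ · κ`. [cite: Hartshorne1977, II Ex. 8.3 (a) and III §6] -/
lemma biprodAddEquiv_cotangentProdRestrict_fst (κ : DefT1.{w} X) :
    (Ext.biprodAddEquiv (cotangentProdRestrict p₁ p₂ κ)).1 = cotangentRestrict p₁ κ := by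
  rw [Ext.biprodAddEquiv_apply_fst, cotangentProdRestrict_apply, ← Ext.comp_assoc_of_second_deg_zero, Ext.mk₀_comp_mk₀,
    biprod.inl_desc]
  rfl

/-- the second component of `(dp₁, dp₂) · κ` is the cotangent block `dp₂ · κ`. [cite: Hartshorne1977, II Ex. 8.3 (a) and III §6] -/
lemma biprodAddEquiv_cotangentProdRestrict_snd (κ : DefT1.{w} X) :
    (Ext.biprodAddEquiv (cotangentProdRestrict p₁ p₂ κ)).2 = cotangentRestrict p₂ κ := by
  rw [Ext.biprodAddEquiv_apply_snd, cotangentProdRestrict_apply, ← Ext.comp_assoc_of_second_deg_zero, Ext.mk₀_comp_mk₀,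
    biprod.inr_desc]
  rfl

/-- under the product formula, `κ ↦ (dp₁, dp₂) · κ` is bijective (pre-composition with an isomorphism).
[cite: Hartshorne1977, II Ex. 8.3 (a) and III §6] -/
lemma cotangentProdRestrict_bijective (hp : IsIso (cotangentProdComparison p₁ p₂)) :
    Function.Bijective (cotangentProdRestrict p₁ p₂ : DefT1.{w} X → _) := by
  have key : ∀ κ : DefT1.{w} X,
      (Ext.mk₀ (inv (cotangentProdComparison p₁ p₂))).comp (cotangentProdRestrict p₁ p₂ κ) (zero_add 1) = κ := by
    intro κ
    rw [cotangentProdRestrict_apply, ← Ext.comp_assoc_of_second_deg_zero, Ext.mk₀_comp_mk₀, IsIso.inv_hom_id,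
      Ext.mk₀_id_comp]
  refine ⟨fun κ₁ κ₂ h => by rw [← key κ₁, ← key κ₂, h], fun y => ⟨(Ext.mk₀ (inv (cotangentProdComparison p₁ p₂))).comp y (zero_add 1), ?_⟩⟩
  rw [cotangentProdRestrict_apply, ← Ext.comp_assoc_of_second_deg_zero, Ext.mk₀_comp_mk₀, IsIso.hom_inv_id, Ext.mk₀_id_comp]

/-- **The cotangent (Künneth) blocks of `T¹` of a binary product**: under the product formula
`T¹(X/S) ≃+ Ext¹(p₁^*Ω¹_{Y₁/S}, 𝒪_X) × Ext¹(p₂^*Ω¹_{Y₂/S}, 𝒪_X)` (Mathlib `Ext.biprodAddEquiv`: `Ext` is additive in the first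
variable), `κ ↦ (dp₁ · κ, dp₂ · κ)`. [cite: Hartshorne1977, II Ex. 8.3 (a) and III Prop. 6.4 ∕ §6] [cite: GortzWedhorn2023, Cor. 17.32 (product formula for Ω¹)] -/
def cotangentBlocksEquivProd (hp : IsIso (cotangentProdComparison p₁ p₂)) :
    DefT1.{w} X ≃+
      Ext.{w} ((Scheme.Modules.pullback p₁.left).obj (cotangentSheaf Y₁)) (unitModule X.left) 1 ×
        Ext.{w} ((Scheme.Modules.pullback p₂.left).obj (cotangentSheaf Y₂)) (unitModule X.left) 1 :=
  (AddEquiv.ofBijective (cotangentProdRestrict p₁ p₂) (cotangentProdRestrict_bijective p₁ p₂ hp)).trans Ext.biprodAddEquiv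

/-- first component of `cotangentBlocksEquivProd` = the block `dp₁ · κ`. [cite: Hartshorne1977, II Ex. 8.3 (a) and III §6] -/
@[simp] lemma cotangentBlocksEquivProd_apply_fst (hp : IsIso (cotangentProdComparison p₁ p₂)) (κ : DefT1.{w} X) :
    (cotangentBlocksEquivProd p₁ p₂ hp κ).1 = cotangentRestrict p₁ κ :=
  biprodAddEquiv_cotangentProdRestrict_fst p₁ p₂ κ

/-- second component of `cotangentBlocksEquivProd` = the block `dp₂ · κ`. [cite: Hartshorne1977, II Ex. 8.3 (a) and III §6] -/
@[simp] lemma cotangentBlocksEquivProd_apply_snd (hp : IsIso (cotangentProdComparison p₁ p₂)) (κ : DefT1.{w} X) :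
    (cotangentBlocksEquivProd p₁ p₂ hp κ).2 = cotangentRestrict p₂ κ :=
  biprodAddEquiv_cotangentProdRestrict_snd p₁ p₂ κ

/-- **a first-order deformation of `Y₁ ×_S Y₂` is zero iff both cotangent blocks are** (product formula).
[cite: Hartshorne1977, II Ex. 8.3 (a) and III §6] [cite: GortzWedhorn2023, Cor. 17.32] -/
theorem eq_zero_iff_cotangentRestrict_eq_zero_prod (hp : IsIso (cotangentProdComparison p₁ p₂)) (κ : DefT1.{w} X) :
    κ = 0 ↔ cotangentRestrict p₁ κ = 0 ∧ cotangentRestrict p₂ κ = 0 := by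
  rw [← (cotangentBlocksEquivProd p₁ p₂ hp).map_eq_zero_iff, Prod.ext_iff, cotangentBlocksEquivProd_apply_fst,
    cotangentBlocksEquivProd_apply_snd]
  rfl

/-! ### Finite products -/

variable {J : Type} [Fintype J] {Y' : J → Over (Spec (CommRingCat.of S))} (p : (j : J) → (X ⟶ Y' j))
  [HasFiniteBiproducts X.left.Modules]

/-- the family `(dp_j)_j` assembled on the biproduct: `⊕_j p_j^*Ω¹_{Y_j/S} ⟶ Ω¹_{X/S}`; the PRODUCT FORMULA for
`X = ∏_j Y_j` says this is an isomorphism.  (The instance argument `HasFiniteBiproducts X.left.Modules` is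
`CategoryTheory.Abelian.hasFiniteBiproducts`, not registered as an instance by Mathlib.)
[cite: Hartshorne1977, II Ex. 8.3 (a) (Ω of a product)] [cite: GortzWedhorn2023, Cor. 17.32] -/
abbrev cotangentProductComparison :
    (⨁ fun j => (Scheme.Modules.pullback (p j).left).obj (cotangentSheaf (Y' j))) ⟶ cotangentSheaf X :=
  biproduct.desc fun j => cotangentSheaf.pullbackHom (p j)

/-- pre-composition with the comparison map: `κ ↦ (dp_j)_j · κ ∈ Ext¹(⊕_j p_j^*Ω¹_{Y_j/S}, 𝒪_X)`.
[cite: Hartshorne1977, II Ex. 8.3 (a) and III §6] -/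
def cotangentProductRestrict :
    DefT1.{w} X →+
      Ext.{w} (⨁ fun j => (Scheme.Modules.pullback (p j).left).obj (cotangentSheaf (Y' j))) (unitModule X.left) 1 :=
  (Ext.mk₀ (cotangentProductComparison p)).precomp (unitModule X.left) (zero_add 1)

/-- Unfolding `cotangentProductRestrict`. [cite: Hartshorne1977, II Ex. 8.3 (a) and III §6] -/
lemma cotangentProductRestrict_apply (κ : DefT1.{w} X) :
    cotangentProductRestrict p κ = (Ext.mk₀ (cotangentProductComparison p)).comp κ (zero_add 1) := rfl

/-- the `j`-th component of `(dp)·κ` on the biproduct is the cotangent block `dp_j · κ`. [cite: Hartshorne1977, II Ex. 8.3 (a) and III §6] -/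
lemma biproductAddEquiv_cotangentProductRestrict (κ : DefT1.{w} X) (j : J) :
    Ext.biproductAddEquiv (biproduct.isBilimit fun j => (Scheme.Modules.pullback (p j).left).obj (cotangentSheaf (Y' j)))
        (unitModule X.left) 1 (cotangentProductRestrict p κ) j =
      cotangentRestrict (p j) κ := by
  change (Ext.mk₀ (biproduct.ι _ j)).comp ((Ext.mk₀ (cotangentProductComparison p)).comp κ (zero_add 1)) (zero_add 1) = _
  rw [← Ext.comp_assoc_of_second_deg_zero, Ext.mk₀_comp_mk₀, biproduct.ι_desc]
  rfl

/-- under the product formula, `κ ↦ (dp_j)_j · κ` is bijective. [cite: Hartshorne1977, II Ex. 8.3 (a) and III §6] -/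
lemma cotangentProductRestrict_bijective (hp : IsIso (cotangentProductComparison p)) :
    Function.Bijective (cotangentProductRestrict p : DefT1.{w} X → _) := by
  have key : ∀ κ : DefT1.{w} X,
      (Ext.mk₀ (inv (cotangentProductComparison p))).comp (cotangentProductRestrict p κ) (zero_add 1) = κ := by
    intro κ
    rw [cotangentProductRestrict_apply, ← Ext.comp_assoc_of_second_deg_zero, Ext.mk₀_comp_mk₀, IsIso.inv_hom_id,
      Ext.mk₀_id_comp]
  refine ⟨fun κ₁ κ₂ h => by rw [← key κ₁, ← key κ₂, h], fun y => ⟨(Ext.mk₀ (inv (cotangentProductComparison p))).comp y (zero_add 1), ?_⟩⟩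
  rw [cotangentProductRestrict_apply, ← Ext.comp_assoc_of_second_deg_zero, Ext.mk₀_comp_mk₀, IsIso.hom_inv_id, Ext.mk₀_id_comp]

/-- **The cotangent (Künneth) block decomposition of `T¹` of a finite product**: under the product formula
`IsIso ((dp_j)_j : ⊕_j p_j^*Ω¹_{Y_j/S} ⟶ Ω¹_{X/S})`, `T¹(X/S) ≃+ Π_j Ext¹(p_j^*Ω¹_{Y_j/S}, 𝒪_X)` (Mathlib `Ext.biproductAddEquiv`),
with components `cotangentRestrict (p j)` (`cotangentBlocksEquiv_apply`) — the decomposition of the first-order deformations of a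
product by the factor whose `1`-forms they move.
[cite: Hartshorne1977, II Ex. 8.3 (a) and III Prop. 6.4 ∕ §6 (Ext additive)] [cite: GortzWedhorn2023, Cor. 17.32 (product formula for Ω¹)] -/
def cotangentBlocksEquiv (hp : IsIso (cotangentProductComparison p)) :
    DefT1.{w} X ≃+ ((j : J) → Ext.{w} ((Scheme.Modules.pullback (p j).left).obj (cotangentSheaf (Y' j))) (unitModule X.left) 1) :=
  (AddEquiv.ofBijective (cotangentProductRestrict p) (cotangentProductRestrict_bijective p hp)).trans
    (Ext.biproductAddEquiv (biproduct.isBilimit fun j => (Scheme.Modules.pullback (p j).left).obj (cotangentSheaf (Y' j)))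
      (unitModule X.left) 1)

/-- the components of `cotangentBlocksEquiv` are the cotangent blocks `κ ↦ dp_j · κ`. [cite: Hartshorne1977, II Ex. 8.3 (a) and III §6] -/
@[simp] lemma cotangentBlocksEquiv_apply (hp : IsIso (cotangentProductComparison p)) (κ : DefT1.{w} X) (j : J) :
    cotangentBlocksEquiv p hp κ j = cotangentRestrict (p j) κ :=
  biproductAddEquiv_cotangentProductRestrict p κ j

/-- **a first-order deformation of a product is zero iff all its cotangent blocks are** (product formula): the cotangent
blocks are jointly injective. [cite: Hartshorne1977, II Ex. 8.3 (a) and III §6] [cite: GortzWedhorn2023, Cor. 17.32] -/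
theorem cotangentRestrict_jointlyInjective (hp : IsIso (cotangentProductComparison p)) :
    JointlyInjective (M := DefT1.{w} X) (fun j => cotangentRestrict (p j)) := by
  intro κ hκ
  apply (cotangentBlocksEquiv p hp).injective
  rw [map_zero]
  funext j
  rw [cotangentBlocksEquiv_apply]
  exact hκ j

/-- equivalently: `κ = 0 ↔ ∀ j, dp_j · κ = 0`. [cite: Hartshorne1977, II Ex. 8.3 (a) and III §6] -/
theorem eq_zero_iff_forall_cotangentRestrict_eq_zero (hp : IsIso (cotangentProductComparison p)) (κ : DefT1.{w} X) :
    κ = 0 ↔ ∀ j, cotangentRestrict (p j) κ = 0 :=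
  (cotangentRestrict_jointlyInjective p hp).eq_zero_iff κ

end Cotangent

/-! ## §4 Obstruction blocks of a bundle along a family of first-order deformations -/

section ObstructionBlocks

variable {S : Type u} [CommRing S] {X : Over (Spec (CommRingCat.of S))} [HasExt.{w} X.left.Modules]
  {N : Type v₃} [AddCommGroup N]
  (hΩ : IsFiniteLocallyFree (cotangentSheaf X)) {E : X.left.Modules} (hE : IsFiniteLocallyFree E)

/-- **the `π`-block of `ob(E)` detects along `W`**: `π (σ_0 (ob_κ(E))) ≠ 0` for some `κ ∈ W` — for a line bundle `L` on a product
and `π` a Künneth projector of `H²(X, 𝒪_X)`: «the Künneth block of `ob(L) κ` is non-zero for some `κ` of the family».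
[cite: HuybrechtsThomas2010, Cor. 3.4 (arXiv p. 10)] [cite: BuchweitzFlenner2003, §1 (σ_0)] -/
abbrev ObstructionBlockDetectsAlong (π : structureSheafCohomology X.left 2 →+ N) (W : Set (DefT1.{w} X)) : Prop :=
  BlockDetectsAlong π (obstructionTrace hΩ hE) W

/-- Unfolding `ObstructionBlockDetectsAlong`: `∃ κ ∈ W, π (σ_0 (ob_κ(E))) ≠ 0`. [cite: HuybrechtsThomas2010, Cor. 3.4 (arXiv p. 10)] -/
lemma obstructionBlockDetectsAlong_iff (π : structureSheafCohomology X.left 2 →+ N) (W : Set (DefT1.{w} X)) :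
    ObstructionBlockDetectsAlong hΩ hE π W ↔ ∃ κ ∈ W, π (sigmaZero hE (kodairaSpencerObstruction hΩ hE κ)) ≠ 0 := Iff.rfl

variable {π : structureSheafCohomology X.left 2 →+ N} {W : Set (DefT1.{w} X)}

/-- **no block of `ob(E)` detects along a family that preserves `E`** (`W ⊆ T¹(X/S)_{E}`).
[cite: HuybrechtsThomas2010, Cor. 3.4 (arXiv p. 10)] -/
theorem not_obstructionBlockDetectsAlong_of_subset_polarisedSubgroup
    (hW : W ⊆ (polarisedSubgroup hΩ hE : Set (DefT1.{w} X))) : ¬ ObstructionBlockDetectsAlong hΩ hE π W :=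
  (not_blockDetectsAlong_iff π _ W).2 (blockVanishesAlong_obstructionTrace_of_subset hΩ hE π hW)

/-- a detecting block witnesses a direction of `W` along which `E` does NOT extend (`ob_κ(E) ≠ 0`).
[cite: HuybrechtsThomas2010, Cor. 3.4 (arXiv p. 10)] -/
theorem exists_kodairaSpencerObstruction_ne_zero_of_obstructionBlockDetectsAlong (h : ObstructionBlockDetectsAlong hΩ hE π W) :
    ∃ κ ∈ W, kodairaSpencerObstruction hΩ hE κ ≠ 0 := by
  obtain ⟨κ, hκ, hne⟩ := BlockDetectsAlong.exists_ne_zero h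
  refine ⟨κ, hκ, fun h0 => hne ?_⟩
  rw [obstructionTrace_apply, h0, map_zero]

/-- **dictionary shape**: for `σ_0` injective (line bundles) and a jointly injective reader family (Künneth projectors), NO block of
`ob(E)` detects along `W` iff `W` preserves `E`. [cite: HuybrechtsThomas2010, Cor. 3.4 (arXiv p. 10)] [cite: BuchweitzFlenner2003, §1 (σ_0 injective)] -/
theorem forall_not_obstructionBlockDetectsAlong_iff {ι : Type v} {N' : ι → Type v₃} [∀ i, AddCommGroup (N' i)]
    {π' : (i : ι) → (structureSheafCohomology X.left 2 →+ N' i)} (hπ : JointlyInjective π') (hσ : IsZeroSemiregular hE) :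
    (∀ i, ¬ ObstructionBlockDetectsAlong hΩ hE (π' i) W) ↔ W ⊆ (polarisedSubgroup hΩ hE : Set (DefT1.{w} X)) := by
  constructor
  · intro h
    exact subset_polarisedSubgroup_of_forall_blockVanishesAlong hΩ hE hπ hσ
      fun i => (not_blockDetectsAlong_iff (π' i) _ W).1 (h i)
  · intro hW i
    exact not_obstructionBlockDetectsAlong_of_subset_polarisedSubgroup hΩ hE hW

end ObstructionBlocks

end Literature.AlgebraicGeometry.Deformation.FirstOrder

end
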